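import Literature.AnabelianGeometry.EtaleTheta.Discharge.Sec5Thm57AnchoredFamily

/-!
# [EtTh] §5, Theorem 5.7: the anabelian residual `hc` ISOLATED as one Kummer-rigidity clause per level (pp. 329–331 / PDF pp. 103–105)

Mochizuki, *The étale theta function …*, Publ. RIMS **45** (2009)
[cite: MochizukiEtTh2009, Thm 5.7 p.330 (PDF p.104); Rmk 4.3.2 p.319 (PDF p.93); Lem 5.8 p.331 (PDF p.105); Prop 3.2 (iii)
p.296 (PDF p.70)].  Seat abc-iut-L2-d4 (gen 5; node `EtTh:Thm5.7`, row R219).  PROOF-ONLY over this seat's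
`Sec5Thm57AnchoredFamily.lean` (p442166) and `Sec5Thm57Descent.lean` (`pow_eq_one_of_kummerTrivial`, p417811).

THE POINT.  After the anchored knit, the ONE residual of Theorem 5.7 that is not a structural / §4 input is `hc`: "the
level-1 unit discrepancy `u₁ = c ∈ K^×` of `Ψ` is a `2l`-th root of unity" (Rmk. 5.7.1: the `2l`-th-root-of-unity rigidity is
"substantially stronger" than the constant-function indeterminacy seen by divisors).  Print (proof of Thm. 5.7, p.330) obtains it
"by considering compatible systems as in Remark 4.3.2 and applying the theory of the rigidity of the étale theta function
[Cor. 2.8 (i)] to the Kummer classes of Prop. 5.2 (iii) … in light of the crucial isomorphisms of Prop. 5.5, which, by Thm. 5.6,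
are preserved by `Ψ`" — i.e. AT EVERY LEVEL `N` the Kummer character on `Π^tp_Y` of the level-`N` discrepancy `w_N` (an `N`-th
root of `c`, by the descent along `β_{1,N}` and the unit law) is that of a FIXED `ζ ∈ μ_{2l}(K)`; then "Π_Y-invariant units of
`B_N` are constants of `K`" (Lemma 5.8, `Y` geometrically connected) makes `c·ζ⁻¹` an `N`-th power in `K^×` for every `N`, and
`⋂_N (K^×)^N = 1` (Prop. 3.2 (iii) / Rmk. 4.3.2 "a compatible system of Kummer classes … is sufficient to distinguish") forces
`c = ζ`.  This file proves exactly that assembly: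
* `ThetaFrobenioidTower.pow_two_l_eq_one_of_kummerRigid` — `c^{2l} = 1` from: no divisible constants (`hK`), Lemma 5.8's
  "Π_Y-fixed units are constants" at every level (`hgc`), `N`-th roots `w_N ∈ O^×(B_N)` of `c` at every level (`hpow`), and the
  KUMMER-RIGIDITY CLAUSE `hrigid`: `∃ ζ, ζ^{2l} = 1 ∧ ∀ N, ∃ ξ_N ∈ O^×(B_N)` with `ξ_N^N = ζ` and `w_N·ξ_N⁻¹` fixed by the
  `Π_Y`-action through `s^⊓-gp_N` — the §5-currency statement that Cor. 2.8 (i) + Prop. 5.2 (iii) + Thm. 5.6 deliver in print;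
* `ThetaFrobenioidTower.thetaRootPreservedAll_of_anchoredFamily_of_kummerRigid` — the anchored all-levels Theorem 5.7
  (`thetaRootPreservedAll_of_anchoredFamily`) with `hc` REPLACED by {`hK`, `hgc` at every level, `hrigid` for the family's
  discrepancies `(w_N)_N`} (the `N`-th-root clause `hpow` is DERIVED: descent `w_N ≫ β_{1,N} = β_{1,N} ≫ u₁`
  (`discrepancy_comp_beta_of_transports`) + the unit law `hconst`).
HONEST FRAMING: kernel-checked implications between typed statements about the §5 data under named hypotheses; `hrigid` is NOT
proved here (it is the content of Cor. 2.8 (i) on the classes of Prop. 5.2 (iii), the next junction); nothing of [EtTh] is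
asserted unconditionally; typed ≠ discharged; no side taken on anything downstream ([IUTchIII] Cor. 3.12 in particular). -/

namespace Literature.AnabelianGeometry.EtaleTheta

open CategoryTheory
open Literature.AlgebraicGeometry.Frobenioids

universe w v v' u u'

namespace ThetaFrobenioidTower

variable {C : Type u} [Category.{v} C] {D : Type u'} [Category.{v'} D] (𝔗 : ThetaFrobenioidTower.{w} C D)
  (Ψ : C ≌ C)

/-- **`c^{2l} = 1` from Kummer rigidity at every level** (the last paragraph of print's proof of Thm. 5.7, p.330 (PDF p.104),
with Rmk. 4.3.2 p.319 and Lemma 5.8 p.331): if `K^×` has no non-trivial divisible element (`hK`), the `Π_Y`-fixed units of every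
`B_N` are constants of `K` (`hgc`, Lemma 5.8), `w_N ∈ O^×(B_N)` is an `N`-th root of the constant `c` at every level (`hpow`), and
there are `ζ ∈ K^×` with `ζ^{2l} = 1` and, at every level, an `N`-th root `ξ_N ∈ O^×(B_N)` of `ζ` such that `w_N·ξ_N⁻¹` is
`Π_Y`-fixed (`hrigid` — the Kummer character of `w_N` on `Π^tp_Y` is that of `ζ`: Cor. 2.8 (i) on the classes of Prop. 5.2 (iii)
via Prop. 5.5/Thm. 5.6), then `c^{2l} = 1`.  [cite: MochizukiEtTh2009, Thm 5.7 p.330 (PDF p.104); Lem 5.8 p.331 (PDF p.105); Prop 3.2 (iii) p.296 (PDF p.70)] -/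
theorem pow_two_l_eq_one_of_kummerRigid
    (hK : ∀ x : 𝔗.Kˣ, (∀ N : ℕ+, ∃ d : 𝔗.Kˣ, d ^ (N : ℕ) = x) → x = 1)
    (hgc : ∀ (N : ℕ+) (u : (𝔗.atLevel N).units (𝔗.BN N)),
      (∀ y ∈ (𝔗.atLevel N).imPiY, 𝔗.sgpCap N y * (u : Aut (𝔗.BN N)) * (𝔗.sgpCap N y)⁻¹ = u) →
        (𝔗.atLevel N).unitsToBirat (𝔗.BN N) u ∈ (𝔗.constEmb N).range)
    {c : 𝔗.Kˣ} (wf : ∀ N : ℕ+, Aut (𝔗.BN N)) (hw : ∀ N : ℕ+, wf N ∈ (𝔗.atLevel N).units (𝔗.BN N))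
    (hpow : ∀ N : ℕ+, (𝔗.atLevel N).unitsToBirat (𝔗.BN N) ⟨wf N, hw N⟩ ^ (N : ℕ) = 𝔗.constEmb N c)
    (hrigid : ∃ ζ : 𝔗.Kˣ, ζ ^ (2 * 𝔗.l) = 1 ∧ ∀ N : ℕ+, ∃ ξ : (𝔗.atLevel N).units (𝔗.BN N),
      (𝔗.atLevel N).unitsToBirat (𝔗.BN N) ξ ^ (N : ℕ) = 𝔗.constEmb N ζ ∧
      ∀ y ∈ (𝔗.atLevel N).imPiY,
        𝔗.sgpCap N y * (wf N * (ξ : Aut (𝔗.BN N))⁻¹) * (𝔗.sgpCap N y)⁻¹ = wf N * (ξ : Aut (𝔗.BN N))⁻¹) :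
    c ^ (2 * 𝔗.l) = 1 := by
  obtain ⟨ζ, hζ, hN⟩ := hrigid
  refine pow_eq_one_of_kummerTrivial hK ⟨ζ, hζ, fun N => ?_⟩
  obtain ⟨⟨ξv, hξv⟩, hξ, hinv⟩ := hN N
  -- the `Π_Y`-fixed unit `w_N·ξ_N⁻¹` is a constant `d` (Lemma 5.8)
  have hmem : wf N * ξv⁻¹ ∈ (𝔗.atLevel N).units (𝔗.BN N) := mul_mem (hw N) (inv_mem hξv)
  obtain ⟨d, hd⟩ := hgc N ⟨wf N * ξv⁻¹, hmem⟩ hinv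
  -- everything read in the tower's own currency (`(𝔗.atLevel N).unitsToBirat = 𝔗.unitsToBirat`, `rfl`)
  have hd' : 𝔗.constEmb N d = 𝔗.unitsToBirat (𝔗.BN N) ⟨wf N * ξv⁻¹, hmem⟩ := hd
  have h1 : 𝔗.unitsToBirat (𝔗.BN N) ⟨wf N, hw N⟩ ^ (N : ℕ) = 𝔗.constEmb N c := hpow N
  have h2 : 𝔗.unitsToBirat (𝔗.BN N) ⟨ξv, hξv⟩ ^ (N : ℕ) = 𝔗.constEmb N ζ := hξ
  have hsplit : (⟨wf N * ξv⁻¹, hmem⟩ : 𝔗.pre.unitsSubgroup (𝔗.BN N)) = ⟨wf N, hw N⟩ * ⟨ξv, hξv⟩⁻¹ :=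
    Subtype.ext rfl
  refine ⟨d, 𝔗.constEmb_injective N ?_⟩
  -- `d^N = c·ζ⁻¹` read in `O^×(B_N^birat)`
  rw [map_pow, hd', hsplit, map_mul, map_inv, mul_pow, inv_pow, h1, h2, map_mul, map_inv]

/-- **[EtTh] Theorem 5.7 (root level) at ALL levels, anchored form, with the anabelian residual in Kummer-rigidity shape.**
`thetaRootPreservedAll_of_anchoredFamily` (p442166) with its binder `hc` ("the level-1 discrepancy constant is a `2l`-th root of
unity") REPLACED by: no divisible constants in `K^×` (`hK`); Lemma 5.8's "Π_Y-fixed units of `B_N` are constants of `K`" at EVERY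
level (`hgc`); and the Kummer-rigidity clause for the family's discrepancies `(w_N)_N` (`hrigid`: ∃ `ζ`, `ζ^{2l} = 1`, and at every
level an `N`-th root `ξ_N ∈ O^×(B_N)` of `ζ` with `w_N·ξ_N⁻¹` fixed by `Π^tp_Y` through `s^⊓-gp_N` — Cor. 2.8 (i) on the classes of
Prop. 5.2 (iii) via Prop. 5.5/Thm. 5.6, p.330).  The clause "`w_N` is an `N`-th root of `c`" is DERIVED from the coherence of the
family (descent `w_N ≫ β_{1,N} = β_{1,N} ≫ u₁`, `discrepancy_comp_beta_of_transports`) and the unit law `hconst`.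
[cite: MochizukiEtTh2009, Thm 5.7 p.329–330 (PDF pp.103–104); Rmk 4.3.2 p.318–319 (PDF pp.92–93); Lem 5.8 p.331 (PDF p.105)] -/
theorem thetaRootPreservedAll_of_anchoredFamily_of_kummerRigid (hepi : ∀ ⦃X Y : C⦄ (f : X ⟶ Y), Epi f)
    (hconst : ∀ (N : ℕ+) (u : Aut (𝔗.BN N)) (hu : u ∈ (𝔗.atLevel N).units (𝔗.BN N)) (u₁ : Aut (𝔗.BN 1))
      (hu₁ : u₁ ∈ (𝔗.atLevel 1).units (𝔗.BN 1)) (c : 𝔗.Kˣ),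
      u.hom ≫ 𝔗.β (one_dvd_level N) = 𝔗.β (one_dvd_level N) ≫ u₁.hom →
      (𝔗.atLevel 1).unitsToBirat (𝔗.BN 1) ⟨u₁, hu₁⟩ = 𝔗.constEmb 1 c →
        (𝔗.atLevel N).unitsToBirat (𝔗.BN N) ⟨u, hu⟩ ^ (N : ℕ) = 𝔗.constEmb N c)
    (hcap₁ : (𝔗.atLevel 1).SgpCapSpec) (hcup₁ : (𝔗.atLevel 1).SgpCupSpec)
    (hdiff₁ : (𝔗.atLevel 1).BiKummerDifferenceMem) (h58₁ : (𝔗.atLevel 1).ConstantsActByCyclotome)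
    (hfac₁ : ∀ y ∈ (𝔗.atLevel 1).imPiY, ∃ h ∈ (𝔗.atLevel 1).HB, ∀ u ∈ (𝔗.atLevel 1).units (𝔗.BN 1),
      𝔗.sgpCap 1 y * u * (𝔗.sgpCap 1 y)⁻¹ = 𝔗.sgpCap 1 h * u * (𝔗.sgpCap 1 h)⁻¹)
    -- the anabelian residual, Kummer-rigidity shape
    (hK : ∀ x : 𝔗.Kˣ, (∀ N : ℕ+, ∃ d : 𝔗.Kˣ, d ^ (N : ℕ) = x) → x = 1)
    (hgc : ∀ (N : ℕ+) (u : (𝔗.atLevel N).units (𝔗.BN N)),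
      (∀ y ∈ (𝔗.atLevel N).imPiY, 𝔗.sgpCap N y * (u : Aut (𝔗.BN N)) * (𝔗.sgpCap N y)⁻¹ = u) →
        (𝔗.atLevel N).unitsToBirat (𝔗.BN N) u ∈ (𝔗.constEmb N).range)
    -- the normalised ANCHOR at the first root
    {α₁ : Ψ.functor.obj (𝔗.AN 1) ≅ 𝔗.AN 1} {β₁ : Ψ.functor.obj (𝔗.BN 1) ≅ 𝔗.BN 1} {u₁ : Aut (𝔗.BN 1)}
    (hT₁ : α₁.inv ≫ Ψ.functor.map (𝔗.sCap 1) ≫ β₁.hom = 𝔗.sCap 1)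
    (hT₁' : α₁.inv ≫ Ψ.functor.map (𝔗.sCup 1) ≫ β₁.hom = 𝔗.sCup 1 ≫ u₁.hom)
    (hu₁ : u₁ ∈ (𝔗.atLevel 1).units (𝔗.BN 1))
    (hU₁ : ((𝔗.atLevel 1).units (𝔗.BN 1)).map ((𝔗.atLevel 1).psiAut Ψ β₁) = (𝔗.atLevel 1).units (𝔗.BN 1))
    (θ₁ : Aut (𝔗.pre.base.obj (𝔗.BN 1)) ≃* Aut (𝔗.pre.base.obj (𝔗.BN 1)))
    (hstrv₁ : (𝔗.atLevel 1).StrvTransport Ψ α₁ (Iso.refl _) θ₁)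
    (hYdd₁ : (𝔗.atLevel 1).HB.map θ₁.toMonoidHom = (𝔗.atLevel 1).HB)
    -- the family, coherent with the anchor
    (a : ∀ N : ℕ+, Ψ.functor.obj (𝔗.AN N) ≅ 𝔗.AN N) (b : ∀ N : ℕ+, Ψ.functor.obj (𝔗.BN N) ≅ 𝔗.BN N)
    (w : ∀ N : ℕ+, Aut (𝔗.BN N))
    (hw : ∀ N : ℕ+, w N ∈ (𝔗.atLevel N).units (𝔗.BN N))
    (hT : ∀ N : ℕ+, (a N).inv ≫ Ψ.functor.map (𝔗.sCap N) ≫ (b N).hom = 𝔗.sCap N)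
    (hT' : ∀ N : ℕ+, (a N).inv ≫ Ψ.functor.map (𝔗.sCup N) ≫ (b N).hom = 𝔗.sCup N ≫ (w N).hom)
    (hΨα : ∀ N : ℕ+,
      (a N).inv ≫ Ψ.functor.map (𝔗.α (one_dvd_level N)) ≫ α₁.hom = 𝔗.α (one_dvd_level N))
    (hΨβ : ∀ N : ℕ+,
      (b N).inv ≫ Ψ.functor.map (𝔗.β (one_dvd_level N)) ≫ β₁.hom = 𝔗.β (one_dvd_level N))
    -- Kummer rigidity of the family's discrepancies (Cor. 2.8 (i) on Prop. 5.2 (iii)'s classes via Thm. 5.6)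
    (hrigid : ∃ ζ : 𝔗.Kˣ, ζ ^ (2 * 𝔗.l) = 1 ∧ ∀ N : ℕ+, ∃ ξ : (𝔗.atLevel N).units (𝔗.BN N),
      (𝔗.atLevel N).unitsToBirat (𝔗.BN N) ξ ^ (N : ℕ) = 𝔗.constEmb N ζ ∧
      ∀ y ∈ (𝔗.atLevel N).imPiY,
        𝔗.sgpCap N y * (w N * (ξ : Aut (𝔗.BN N))⁻¹) * (𝔗.sgpCap N y)⁻¹ = w N * (ξ : Aut (𝔗.BN N))⁻¹) :
    𝔗.ThetaRootPreservedAll Ψ := by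
  refine 𝔗.thetaRootPreservedAll_of_anchoredFamily Ψ hepi hconst hcap₁ hcup₁ hdiff₁ h58₁ hfac₁ hT₁ hT₁' hu₁ hU₁ θ₁ hstrv₁
    hYdd₁ ?_ a b w hw hT hT' hΨα hΨβ
  intro c hc₁
  refine 𝔗.pow_two_l_eq_one_of_kummerRigid hK hgc w hw (fun N => ?_) hrigid
  -- `w_N` is an `N`-th root of `c`: descent along `β_{1,N}` + the unit law
  have hT₁r : α₁.inv ≫ Ψ.functor.map (𝔗.sCap 1) ≫ β₁.hom =
      (Iso.refl (𝔗.AN 1)).hom ≫ 𝔗.sCap 1 ≫ (1 : Aut (𝔗.BN 1)).hom := by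
    rw [hT₁, Iso.refl_hom, Category.id_comp]
    show 𝔗.sCap 1 = 𝔗.sCap 1 ≫ (Iso.refl (𝔗.BN 1)).hom
    rw [Iso.refl_hom, Category.comp_id]
  have hT₁r' : α₁.inv ≫ Ψ.functor.map (𝔗.sCup 1) ≫ β₁.hom =
      (Iso.refl (𝔗.AN 1)).hom ≫ 𝔗.sCup 1 ≫ u₁.hom := by
    rw [hT₁', Iso.refl_hom, Category.id_comp]
  have hTr : (a N).inv ≫ Ψ.functor.map (𝔗.sCap N) ≫ (b N).hom =
      (Iso.refl (𝔗.AN N)).hom ≫ 𝔗.sCap N ≫ (1 : Aut (𝔗.BN N)).hom := by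
    rw [hT N, Iso.refl_hom, Category.id_comp]
    show 𝔗.sCap N = 𝔗.sCap N ≫ (Iso.refl (𝔗.BN N)).hom
    rw [Iso.refl_hom, Category.comp_id]
  have hTr' : (a N).inv ≫ Ψ.functor.map (𝔗.sCup N) ≫ (b N).hom =
      (Iso.refl (𝔗.AN N)).hom ≫ 𝔗.sCup N ≫ (w N).hom := by
    rw [hT' N, Iso.refl_hom, Category.id_comp]
  have he : 𝔗.α (one_dvd_level N) ≫ (Iso.refl (𝔗.AN 1)).hom = (Iso.refl (𝔗.AN N)).hom ≫ 𝔗.α (one_dvd_level N) := by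
    rw [Iso.refl_hom, Iso.refl_hom, Category.id_comp, Category.comp_id]
  have hcomm := (𝔗.discrepancy_comp_beta_of_transports Ψ hepi (one_dvd_level N) α₁ (a N) β₁ (b N) (hΨα N) (hΨβ N) he
    hT₁r hT₁r' hTr hTr').2.2
  rw [inv_one, one_mul, inv_one, one_mul] at hcomm
  exact hconst N (w N) (hw N) u₁ hu₁ c hcomm hc₁

end ThetaFrobenioidTower

end Literature.AnabelianGeometry.EtaleTheta
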